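import Literature.NumberTheory.Sieve.CFSemigroupTwistedBoundary
import Literature.NumberTheory.Sieve.CFSemigroupRenewalEven
import HarnessLib

/-!
# The congruence renewal theorem for `Γ_A` (fixed modulus, main term)

Support file (all results proved) for the named fact
`Literature.NumberTheory.Sieve.MageeOhWinter2019_uniformCounting` (`CFSemigroupCounting.lean`).
For a FIXED modulus `q` with primitive congruence twists (e.g. `q` prime to `6 (b - a)`), the count
of pair-words of `Γ_A` from the fibre `ξ` to the fibre `ξ₀` of `SL₂(ℤ/qℤ)`,
`N_q(X, x; ξ → ξ₀; G, Φ) = Σ_{w : ξ σ_w = ξ₀, denom(M_w,x) Φ(M_w x) ≤ X} Re G(M_w x)`,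
satisfies `N_q ~ |Γ_q|⁻¹ · ½ ν(G Φ^{-2δ}) c(x) X^{2δ}` — each residue class receives exactly `1/|Γ_q|`
of the even-word count of `CFSemigroupRenewalEven.lean` ([MageeOhWinter2019, §3.2: the main term of
the congruence renewal equation comes from the trivial representation; Thm. 1/Thm. 11 at level `q`,
main term only, no uniformity in `q`]). Ingredients: the resolvent decomposition
`(1 - 𝓜_s)⁻¹ = lift((1 - L_s²)⁻¹) + H(s)` with `H` continuous on `Re s ≥ δ`
(`continuousOn_cfTwH`, from `CFSemigroupTwistedResolvent/Boundary.lean`), the Laplace transform of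
`N_q` as a twisted resolvent, and the Tauberian step `tendsto_of_cfLaplace`.

## References

* M. Magee, H. Oh, D. Winter, J. reine angew. Math. 753 (2019) 89–135, §3.1–3.2, Thm. 11. [MageeOhWinter2019]
-/

noncomputable section

open Set Filter Topology MeasureTheory
open scoped MatrixGroups

namespace Literature.NumberTheory.Sieve

variable {A : Finset ℕ}

section CongRenewal

variable (A) (hA : ∀ a ∈ A, 1 ≤ a) (h2 : 2 ≤ A.card) (q : ℕ) [NeZero q]
include hA

/-! ### The holomorphic part of the twisted resolvent -/

include h2 in
/-- `1 - L_s² = (1 - L_s)(1 + L_s)` is a unit for `Re s ≥ δ`, `s ≠ δ`, and `s ↦ (1 - L_s²)⁻¹` is continuous there.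
[cite: MageeOhWinter2019, Lemma 15] -/
theorem isUnit_one_sub_cfLOp_sq {s : ℂ} (hs : cfDimension A ≤ s.re) (hne : s ≠ (cfDimension A : ℂ)) :
    IsUnit (1 - cfLOp A hA s ^ 2) ∧ ContinuousAt (fun s => Ring.inverse (1 - cfLOp A hA s ^ 2)) s := by
  have hfac : ∀ s : ℂ, 1 - cfLOp A hA s ^ 2 = (1 - cfLOp A hA s) * (1 + cfLOp A hA s) := fun s => by
    rw [sq, mul_add, sub_mul, sub_mul, one_mul, mul_one, one_mul]; abel
  have hu : IsUnit (1 - cfLOp A hA s ^ 2) := by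
    rw [hfac]; exact (isUnit_one_sub_cfLOp A hA h2 hs hne).mul (isUnit_one_add_cfLOp A hA h2 hs)
  refine ⟨hu, ?_⟩
  obtain ⟨u, hu'⟩ := hu
  have h1 : ContinuousAt Ring.inverse ((1 : CfLip →L[ℂ] CfLip) - cfLOp A hA s ^ 2) := by
    rw [← hu']; exact NormedRing.inverse_continuousAt u
  exact ContinuousAt.comp (g := Ring.inverse) h1 (continuous_const.sub ((continuous_cfLOp A hA).pow 2)).continuousAt

open Classical in
/-- **The holomorphic part of the twisted resolvent:** `H(s) = (1 - B_s)⁻¹ P₁` where `1 - B_s` is a unit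
(near `δ`), and `(1 - 𝓜_s)⁻¹ - lift((1 - L_s²)⁻¹)` elsewhere. [cite: MageeOhWinter2019, §3.2] -/
def cfTwH (s : ℂ) : (SL(2, ZMod q) → CfLip) →L[ℂ] (SL(2, ZMod q) → CfLip) :=
  if IsUnit (1 - cfTwB A hA q s) then Ring.inverse (1 - cfTwB A hA q s) * cfTwP1 q
  else Ring.inverse (1 - cfTwist A hA q s) - cfTwLift q (Ring.inverse (1 - cfLOp A hA s ^ 2))

include h2 in
/-- **The resolvent decomposition on `{Re s ≥ δ} \ {δ}`:** `(1 - 𝓜_s)⁻¹ = lift((1 - L_s²)⁻¹) + H(s)`.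
[cite: MageeOhWinter2019, §3.2] -/
theorem cfTwist_inverse_eq_cfTwH {s : ℂ} (hs : cfDimension A ≤ s.re) (hne : s ≠ (cfDimension A : ℂ)) :
    Ring.inverse (1 - cfTwist A hA q s) = cfTwLift q (Ring.inverse (1 - cfLOp A hA s ^ 2)) + cfTwH A hA q s := by
  unfold cfTwH
  split_ifs with hB
  · exact (cfTwist_inverse_eq A hA q (isUnit_one_sub_cfLOp_sq A hA h2 hs hne).1 hB).2
  · abel

include h2 in
/-- **`H` is continuous on the closed half-plane `Re s ≥ δ`** (including `s = δ`). [cite: MageeOhWinter2019, §3.2] -/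
theorem continuousOn_cfTwH {n₀ : ℕ}
    (hprim : ∀ n ≥ n₀, ∀ ξ η : SL(2, ZMod q), ∃ w : List (A × A), w.length = n ∧ ξ * cfSigmaWord A q w = η) :
    ContinuousOn (cfTwH A hA q) {s : ℂ | cfDimension A ≤ s.re} := by
  intro s₀ hs₀
  have hs₀re : cfDimension A ≤ s₀.re := hs₀
  by_cases hB : IsUnit (1 - cfTwB A hA q s₀)
  · -- near `s₀`, `H = (1 - B)⁻¹ P₁`
    have hopen : ∀ᶠ s in 𝓝 s₀, IsUnit (1 - cfTwB A hA q s) :=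
      (continuous_const.sub (continuous_cfTwB A hA q)).continuousAt.preimage_mem_nhds (Units.isOpen.mem_nhds hB)
    have heq : (cfTwH A hA q) =ᶠ[𝓝 s₀] fun s => Ring.inverse (1 - cfTwB A hA q s) * cfTwP1 q := by
      filter_upwards [hopen] with s hs
      unfold cfTwH; rw [if_pos hs]
    refine (ContinuousAt.congr ?_ heq.symm).continuousWithinAt
    exact (continuousAt_inverse_one_sub_cfTwB A hA q hB).mul continuousAt_const
  · -- `s₀ ≠ δ`; near `s₀` within the half-plane, `H = (1 - 𝓜)⁻¹ - lift((1 - L²)⁻¹)`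
    have hne : s₀ ≠ (cfDimension A : ℂ) := by
      intro h; rw [h] at hB; exact hB (isUnit_one_sub_cfTwB_delta A hA h2 q hprim).2
    have hval : ∀ s : ℂ, cfDimension A ≤ s.re → s ≠ (cfDimension A : ℂ) →
        cfTwH A hA q s = Ring.inverse (1 - cfTwist A hA q s) - cfTwLift q (Ring.inverse (1 - cfLOp A hA s ^ 2)) := by
      intro s hs hsne
      have h := cfTwist_inverse_eq_cfTwH A hA h2 q hs hsne
      rw [h]; abel
    have hδopen : ∀ᶠ s in 𝓝[{s : ℂ | cfDimension A ≤ s.re}] s₀, cfDimension A ≤ s.re ∧ s ≠ (cfDimension A : ℂ) := by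
      have h1 : ∀ᶠ s in 𝓝[{s : ℂ | cfDimension A ≤ s.re}] s₀, cfDimension A ≤ s.re := eventually_mem_nhdsWithin
      have h2' : ∀ᶠ s in 𝓝 s₀, s ≠ (cfDimension A : ℂ) := isOpen_ne.mem_nhds hne
      exact h1.and (mem_nhdsWithin_of_mem_nhds h2')
    have heq : (cfTwH A hA q) =ᶠ[𝓝[{s : ℂ | cfDimension A ≤ s.re}] s₀]
        fun s => Ring.inverse (1 - cfTwist A hA q s) - cfTwLift q (Ring.inverse (1 - cfLOp A hA s ^ 2)) := by
      filter_upwards [hδopen] with s hs using hval s hs.1 hs.2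
    refine ContinuousWithinAt.congr_of_eventuallyEq ?_ heq (hval s₀ hs₀re hne)
    have hc1 := (continuousAt_inverse_one_sub_cfTwist A hA q (isUnit_one_sub_cfTwist A hA h2 q hprim hs₀re hne)).continuousWithinAt
      (s := {s : ℂ | cfDimension A ≤ s.re})
    have hc2 : ContinuousAt (fun s => cfTwLift q (Ring.inverse (1 - cfLOp A hA s ^ 2))) s₀ := by
      have hL : ContinuousAt (fun X : CfLip →L[ℂ] CfLip => cfTwLift q X) (Ring.inverse (1 - cfLOp A hA s₀ ^ 2)) := by
        have : Continuous fun X : CfLip →L[ℂ] CfLip => cfTwLift q X := by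
          unfold cfTwLift
          exact ((ContinuousLinearMap.compL ℂ (SL(2, ZMod q) → CfLip) CfLip (SL(2, ZMod q) → CfLip) (cfTwE q)).continuous).comp
            (((ContinuousLinearMap.compL ℂ (SL(2, ZMod q) → CfLip) CfLip CfLip).flip (cfTwAv q)).continuous)
        exact this.continuousAt
      exact ContinuousAt.comp (g := fun X : CfLip →L[ℂ] CfLip => cfTwLift q X) hL (isUnit_one_sub_cfLOp_sq A hA h2 hs₀re hne).2
    exact hc1.sub hc2.continuousWithinAt

/-! ### Flattening pair words into letter words -/

omit hA in
/-- The letter word of a pair word (innermost pair last): `flat(p, w') = flat(w') ++ [p₁, p₂]`. [folklore] -/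
def cfFlat : (n : ℕ) → (Fin n → A × A) → (Fin (2 * n) → A)
  | 0, _ => fun i => Fin.elim0 i
  | n + 1, w => Fin.append (cfFlat n (Fin.tail w)) ![(w 0).1, (w 0).2]

omit hA in
/-- **The flattened word realises the path matrix:** `M_{flat w} = M_w`. [folklore] -/
theorem cfMat_cfFlat : ∀ (n : ℕ) (w : Fin n → A × A),
    cfMat (fun i => (cfFlat A n w i : ℕ)) = cfPathMat A (List.ofFn w)
  | 0, w => by simp [cfPathMat, cfMat]
  | n + 1, w => by
      have happ : (fun i => (cfFlat A (n + 1) w i : ℕ)) =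
          Fin.append (fun i => (cfFlat A n (Fin.tail w) i : ℕ)) ![((w 0).1 : ℕ), ((w 0).2 : ℕ)] := by
        funext i
        refine Fin.addCases (fun j => ?_) (fun j => ?_) i
        · simp [cfFlat]
        · fin_cases j <;> simp [cfFlat]
      rw [happ, cfMat_append, cfMat_cfFlat n (Fin.tail w), cfMat_pair, List.ofFn_succ, cfPathMat]
      rfl

omit hA in
/-- Flattening is injective. [folklore] -/
theorem cfFlat_injective : ∀ n : ℕ, Function.Injective (cfFlat A n)
  | 0 => fun w w' _ => funext fun i => Fin.elim0 i
  | n + 1 => by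
      intro w w' h
      have h' : Fin.append (cfFlat A n (Fin.tail w)) ![(w 0).1, (w 0).2] = Fin.append (cfFlat A n (Fin.tail w')) ![(w' 0).1, (w' 0).2] := h
      have hleft : cfFlat A n (Fin.tail w) = cfFlat A n (Fin.tail w') := by
        funext j
        have := congrFun h' (Fin.castAdd 2 j)
        simpa using this
      have hright : (![(w 0).1, (w 0).2] : Fin 2 → A) = ![(w' 0).1, (w' 0).2] := by
        funext j
        have := congrFun h' (Fin.natAdd (2 * n) j)
        simpa using this
      have htail : Fin.tail w = Fin.tail w' := cfFlat_injective n hleft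
      have h0 : w 0 = w' 0 := by
        have h1 := congrFun hright 0
        have h2' := congrFun hright 1
        simp at h1 h2'
        exact Prod.ext h1 h2'
      rw [← Fin.cons_self_tail w, ← Fin.cons_self_tail w', h0, htail]

/-! ### The congruence counts -/

variable {q}

/-- **The congruence count by number of pairs:**
`N_n(X, x; ξ → ξ₀; G, Φ) = Σ_{|w| = n, ξσ_w = ξ₀, denom(M_w,x) Φ(pt_w x) ≤ X} Re G(pt_w x)`. [cite: MageeOhWinter2019, §3.2] -/
def cfCongLenCountT (Θ : CfThreshold) (G : CfLip) (ξ ξ₀ : SL(2, ZMod q)) (n : ℕ) (X x : ℝ) : ℝ :=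
  ∑ w : Fin n → A × A, (if ξ * cfSigmaWord A q (List.ofFn w) = ξ₀ then (1 : ℝ) else 0) *
    ((G.extend (cfPathPoint A (List.ofFn w) x)).re *
      (if cfDenom (cfPathMat A (List.ofFn w)) x * Θ.Φ (cfPathPoint A (List.ofFn w) x) ≤ X then (1 : ℝ) else 0))

/-- **The congruence count** `N_q(X, x; ξ → ξ₀; G, Φ) = Σ_n N_n`. [cite: MageeOhWinter2019, §3.2] -/
def cfCongCountT (Θ : CfThreshold) (G : CfLip) (ξ ξ₀ : SL(2, ZMod q)) (X x : ℝ) : ℝ :=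
  ∑' n, cfCongLenCountT A Θ G ξ ξ₀ n X x

section Counts

variable (Θ : CfThreshold) {G : CfLip}

omit hA [NeZero q] in
/-- Non-negativity of the congruence counts for `G ≥ 0`. [folklore] -/
theorem cfCongLenCountT_nonneg (hG0 : ∀ y : Icc (0 : ℝ) 1, 0 ≤ (G y).re) (ξ ξ₀ : SL(2, ZMod q)) (n : ℕ) (X x : ℝ) :
    0 ≤ cfCongLenCountT A Θ G ξ ξ₀ n X x :=
  Finset.sum_nonneg fun _ _ => mul_nonneg (by split_ifs <;> norm_num) (mul_nonneg (hG0 _) (by split_ifs <;> norm_num))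

omit hA [NeZero q] in
/-- Monotonicity in `X`. [folklore] -/
theorem cfCongLenCountT_mono (hG0 : ∀ y : Icc (0 : ℝ) 1, 0 ≤ (G y).re) (ξ ξ₀ : SL(2, ZMod q)) (n : ℕ) (x : ℝ) :
    Monotone fun X => cfCongLenCountT A Θ G ξ ξ₀ n X x := by
  intro X Y hXY
  refine Finset.sum_le_sum fun w _ => mul_le_mul_of_nonneg_left (mul_le_mul_of_nonneg_left ?_ (hG0 _)) (by split_ifs <;> norm_num)
  by_cases h : cfDenom (cfPathMat A (List.ofFn w)) x * Θ.Φ (cfPathPoint A (List.ofFn w) x) ≤ X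
  · rw [if_pos h, if_pos (h.trans hXY)]
  · rw [if_neg h]; split_ifs <;> norm_num

/-- Denominators of pair words grow geometrically: `denom(M_w, x) ≥ 2^{|w|}` on `[0,1]`. [folklore] -/
theorem pow_two_le_cfDenom_cfPathMat : ∀ (w : List (A × A)) {x : ℝ}, x ∈ Icc (0 : ℝ) 1 →
    (2 : ℝ) ^ w.length ≤ cfDenom (cfPathMat A w) x
  | [], x, _ => by simp [cfPathMat, cfDenom]
  | p :: w, x, hx => by
      have ha1 : (1 : ℝ) ≤ ((p.1 : A) : ℕ) := by exact_mod_cast hA _ p.1.2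
      have hb1 : (1 : ℝ) ≤ ((p.2 : A) : ℕ) := by exact_mod_cast hA _ p.2.2
      have hxb : cfDenom (cfGen ((p.2 : A) : ℕ)) x ≠ 0 := by rw [cfDenom_cfGen]; linarith [hx.1]
      have hp : (2 : ℝ) ≤ cfDenom (cfGen ((p.1 : A) : ℕ) * cfGen ((p.2 : A) : ℕ)) x := by
        rw [cfDenom_mul _ _ hxb, cfDenom_cfGen, cfDenom_cfGen, cfMoeb_cfGen]
        have h1 : 1 ≤ x + ((p.2 : A) : ℕ) := by linarith [hx.1]
        have h2 : (1 / (x + ((p.2 : A) : ℕ)) + ((p.1 : A) : ℕ)) * (x + ((p.2 : A) : ℕ)) =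
            1 + ((p.1 : A) : ℕ) * (x + ((p.2 : A) : ℕ)) := by field_simp
        rw [mul_comm, h2]; nlinarith
      have hy := cfMoeb_pair_mem (hA _ p.1.2) (hA _ p.2.2) hx
      rw [cfPathMat, cfDenom_mul _ _ (by linarith), List.length_cons, pow_succ]
      have ih := pow_two_le_cfDenom_cfPathMat w hy
      nlinarith [pow_pos (two_pos : (0:ℝ) < 2) w.length]

omit [NeZero q] in
/-- Long pair words are not counted: `N_n(X, x) = 0` once `X < 2ⁿ`. [folklore] -/
theorem cfCongLenCountT_eq_zero (G : CfLip) (ξ ξ₀ : SL(2, ZMod q)) {x : ℝ} (hx : x ∈ Icc (0 : ℝ) 1) {n : ℕ} {X : ℝ}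
    (hX : X < (2 : ℝ) ^ n) : cfCongLenCountT A Θ G ξ ξ₀ n X x = 0 := by
  refine Finset.sum_eq_zero fun w _ => ?_
  have hd := pow_two_le_cfDenom_cfPathMat A hA (List.ofFn w) hx
  rw [List.length_ofFn] at hd
  have hΦ := Θ.one_le _ (cfPathPoint_mem A hA (List.ofFn w) hx)
  have hnot : ¬cfDenom (cfPathMat A (List.ofFn w)) x * Θ.Φ (cfPathPoint A (List.ofFn w) x) ≤ X := by
    intro h; nlinarith [one_le_cfDenom_cfPathMat A hA (List.ofFn w) hx]
  rw [if_neg hnot, mul_zero, mul_zero]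

omit [NeZero q] in
/-- **Comparison with the letter-word count:** `N_n(X, x; ξ → ξ₀; G, Φ) ≤ ‖G‖ · N_{2n}(X, x)` (flattening is
injective and `Φ ≥ 1`). [folklore] -/
theorem cfCongLenCountT_le (G : CfLip) (ξ ξ₀ : SL(2, ZMod q)) (n : ℕ) (X : ℝ) {x : ℝ} (hx : x ∈ Icc (0 : ℝ) 1) :
    cfCongLenCountT A Θ G ξ ξ₀ n X x ≤ ‖G‖ * cfLenCount A (2 * n) X x := by
  classical
  -- termwise: `≤ ‖G‖ · 1{denom(M_{flat w}) ≤ X}`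
  set g : (Fin (2 * n) → A) → ℝ := fun u => if cfDenom (cfMat fun i => (u i : ℕ)) x ≤ X then (1 : ℝ) else 0 with hg
  have hg0 : ∀ u, 0 ≤ g u := fun u => by simp only [hg]; split_ifs <;> norm_num
  have hterm : ∀ w : Fin n → A × A, (if ξ * cfSigmaWord A q (List.ofFn w) = ξ₀ then (1 : ℝ) else 0) *
      ((G.extend (cfPathPoint A (List.ofFn w) x)).re *
        (if cfDenom (cfPathMat A (List.ofFn w)) x * Θ.Φ (cfPathPoint A (List.ofFn w) x) ≤ X then (1 : ℝ) else 0)) ≤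
      ‖G‖ * g (cfFlat A n w) := by
    intro w
    have hre : (G.extend (cfPathPoint A (List.ofFn w) x)).re ≤ ‖G‖ :=
      (Complex.re_le_norm _).trans (G.norm_extend_le _)
    have hind : (if cfDenom (cfPathMat A (List.ofFn w)) x * Θ.Φ (cfPathPoint A (List.ofFn w) x) ≤ X then (1 : ℝ) else 0) ≤
        g (cfFlat A n w) := by
      simp only [hg, cfMat_cfFlat A n w]
      by_cases h : cfDenom (cfPathMat A (List.ofFn w)) x * Θ.Φ (cfPathPoint A (List.ofFn w) x) ≤ X
      · have h' : cfDenom (cfPathMat A (List.ofFn w)) x ≤ X := by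
          have hΦ := Θ.one_le _ (cfPathPoint_mem A hA (List.ofFn w) hx)
          nlinarith [one_le_cfDenom_cfPathMat A hA (List.ofFn w) hx]
        rw [if_pos h, if_pos h']
      · rw [if_neg h]; split_ifs <;> norm_num
    have hind0 : 0 ≤ (if cfDenom (cfPathMat A (List.ofFn w)) x * Θ.Φ (cfPathPoint A (List.ofFn w) x) ≤ X then (1 : ℝ) else 0) := by
      split_ifs <;> norm_num
    have h1 : (G.extend (cfPathPoint A (List.ofFn w) x)).re *
        (if cfDenom (cfPathMat A (List.ofFn w)) x * Θ.Φ (cfPathPoint A (List.ofFn w) x) ≤ X then (1 : ℝ) else 0) ≤ ‖G‖ * g (cfFlat A n w) :=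
      (mul_le_mul_of_nonneg_right hre hind0).trans (mul_le_mul_of_nonneg_left hind (norm_nonneg G))
    have h0 : 0 ≤ ‖G‖ * g (cfFlat A n w) := mul_nonneg (norm_nonneg G) (hg0 _)
    by_cases hσ : ξ * cfSigmaWord A q (List.ofFn w) = ξ₀
    · rw [if_pos hσ, one_mul]; exact h1
    · rw [if_neg hσ, zero_mul]; exact h0
  refine (Finset.sum_le_sum fun w _ => hterm w).trans ?_
  rw [← Finset.mul_sum, cfLenCount]
  refine mul_le_mul_of_nonneg_left ?_ (norm_nonneg G)
  rw [← Finset.sum_image (f := g) fun w _ w' _ h => cfFlat_injective A n h]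
  exact Finset.sum_le_sum_of_subset_of_nonneg (Finset.subset_univ _) fun u _ _ => hg0 u

omit [NeZero q] in
/-- Summability of the congruence counts over the number of pairs (finitely many non-zero). [folklore] -/
theorem summable_cfCongLenCountT (G : CfLip) (ξ ξ₀ : SL(2, ZMod q)) {x : ℝ} (hx : x ∈ Icc (0 : ℝ) 1) (X : ℝ) :
    Summable fun n => cfCongLenCountT A Θ G ξ ξ₀ n X x := by
  obtain ⟨N, hN⟩ := exists_pow_two_gt X
  refine summable_of_ne_finset_zero (s := Finset.range (2 * N)) fun n hn => ?_
  rw [Finset.mem_range, not_lt] at hn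
  refine cfCongLenCountT_eq_zero A hA Θ G ξ ξ₀ hx ?_
  have h2n : (2 : ℝ) ^ N ≤ (2 : ℝ) ^ n := pow_le_pow_right₀ (by norm_num) (by omega)
  rcases lt_or_ge X 1 with h | h
  · exact h.trans_le (one_le_pow₀ (by norm_num : (1 : ℝ) ≤ 2))
  · have : X ≤ X ^ 2 := by nlinarith
    exact this.trans_lt (hN.trans_le h2n)

omit hA [NeZero q] in
/-- Non-negativity of the congruence count. [folklore] -/
theorem cfCongCountT_nonneg (hG0 : ∀ y : Icc (0 : ℝ) 1, 0 ≤ (G y).re) (ξ ξ₀ : SL(2, ZMod q)) (X x : ℝ) :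
    0 ≤ cfCongCountT A Θ G ξ ξ₀ X x :=
  tsum_nonneg fun n => cfCongLenCountT_nonneg A Θ hG0 ξ ξ₀ n X x

omit [NeZero q] in
/-- Monotonicity of the congruence count in `X`. [folklore] -/
theorem cfCongCountT_mono (hG0 : ∀ y : Icc (0 : ℝ) 1, 0 ≤ (G y).re) (ξ ξ₀ : SL(2, ZMod q)) {x : ℝ} (hx : x ∈ Icc (0 : ℝ) 1) :
    Monotone fun X => cfCongCountT A Θ G ξ ξ₀ X x := fun X Y hXY =>
  (summable_cfCongLenCountT A hA Θ G ξ ξ₀ hx X).tsum_le_tsum (fun n => cfCongLenCountT_mono A Θ hG0 ξ ξ₀ n x hXY)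
    (summable_cfCongLenCountT A hA Θ G ξ ξ₀ hx Y)

omit [NeZero q] in
/-- **A priori bound:** `N_q(X, x; ξ → ξ₀; G, Φ) ≤ ‖G‖ · N(X, x)` (the letter-word count of all lengths). [folklore] -/
theorem cfCongCountT_le_norm_mul (G : CfLip) (ξ ξ₀ : SL(2, ZMod q)) {x : ℝ} (hx : x ∈ Icc (0 : ℝ) 1) (X : ℝ) :
    cfCongCountT A Θ G ξ ξ₀ X x ≤ ‖G‖ * cfFullCount A X x := by
  have hs1 := summable_cfCongLenCountT A hA Θ G ξ ξ₀ hx X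
  have hs2 : Summable fun n => ‖G‖ * cfLenCount A (2 * n) X x :=
    ((summable_cfLenCount hA hx X).comp_injective (fun a b h => mul_left_cancel₀ two_ne_zero h)).mul_left ‖G‖
  have h1 : cfCongCountT A Θ G ξ ξ₀ X x ≤ ∑' n, ‖G‖ * cfLenCount A (2 * n) X x :=
    hs1.tsum_le_tsum (fun n => cfCongLenCountT_le A hA Θ G ξ ξ₀ n X hx) hs2
  refine h1.trans ?_
  rw [tsum_mul_left, cfFullCount]
  refine mul_le_mul_of_nonneg_left ?_ (norm_nonneg G)
  exact (summable_cfLenCount hA hx X |>.comp_injective (fun a b h => mul_left_cancel₀ two_ne_zero h)).tsum_le_tsum_of_inj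
    (fun m => 2 * m) (fun a b h => mul_left_cancel₀ two_ne_zero h) (fun n _ => cfLenCount_nonneg n X x) (fun m => le_rfl)
    (summable_cfLenCount hA hx X)

end Counts

/-! ### The Laplace transform of the congruence count -/

section Laplace

variable (Θ : CfThreshold)
include h2

/-- The congruence word indicator as a set indicator in `u`. [folklore] -/
theorem cfCongIndicatorT_eq (w : List (A × A)) {x : ℝ} (hx : x ∈ Icc (0 : ℝ) 1) (g : ℝ) (s : ℂ) (u : ℝ) :
    ((g * (if cfDenom (cfPathMat A w) x * Θ.Φ (cfPathPoint A w x) ≤ Real.exp (u / (2 * cfDimension A)) then (1 : ℝ) else 0) : ℝ) : ℂ) *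
        Complex.exp (-s * u) =
      (g : ℂ) * (Set.Ici (2 * cfDimension A * Real.log (cfDenom (cfPathMat A w) x * Θ.Φ (cfPathPoint A w x)))).indicator
        (fun u : ℝ => Complex.exp (-s * u)) u := by
  have hd : 0 < cfDenom (cfPathMat A w) x * Θ.Φ (cfPathPoint A w x) :=
    mul_pos (by linarith [one_le_cfDenom_cfPathMat A hA w hx]) (Θ.pos (cfPathPoint_mem A hA w hx))
  by_cases h : 2 * cfDimension A * Real.log (cfDenom (cfPathMat A w) x * Θ.Φ (cfPathPoint A w x)) ≤ u
  · have h1 := (cfDenom_le_exp_iff A hA h2 hd u).2 h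
    simp [Set.indicator, Set.mem_Ici, h, h1]
  · have h1 : ¬cfDenom (cfPathMat A w) x * Θ.Φ (cfPathPoint A w x) ≤ Real.exp (u / (2 * cfDimension A)) := fun h' =>
      h ((cfDenom_le_exp_iff A hA h2 hd u).1 h')
    simp [Set.indicator, Set.mem_Ici, h, h1]

omit [NeZero q] in
/-- The integrand as a finite sum of indicators. [folklore] -/
theorem cfCongLenCountT_mul_cexp_eq (G : CfLip) (ξ ξ₀ : SL(2, ZMod q)) (n : ℕ) (x : Icc (0 : ℝ) 1) (s : ℂ) (u : ℝ) :
    (cfCongLenCountT A Θ G ξ ξ₀ n (Real.exp (u / (2 * cfDimension A))) x : ℂ) * Complex.exp (-s * u) =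
      ∑ w : Fin n → A × A, (((if ξ * cfSigmaWord A q (List.ofFn w) = ξ₀ then (1 : ℝ) else 0 : ℝ)) : ℂ) *
        (((G.extend (cfPathPoint A (List.ofFn w) x)).re : ℂ) *
          (Set.Ici (2 * cfDimension A * Real.log (cfDenom (cfPathMat A (List.ofFn w)) x *
            Θ.Φ (cfPathPoint A (List.ofFn w) x)))).indicator (fun u : ℝ => Complex.exp (-s * u)) u) := by
  rw [cfCongLenCountT, Complex.ofReal_sum, Finset.sum_mul]
  refine Finset.sum_congr rfl fun w _ => ?_
  rw [Complex.ofReal_mul, mul_assoc, cfCongIndicatorT_eq A hA h2 Θ (List.ofFn w) x.2 _ s u]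

/-- The family fed to the congruence operator: `G_s` in the fibre `ξ₀`. [folklore] -/
def cfCongFam (G : CfLip) (ξ₀ : SL(2, ZMod q)) (s : ℂ) : SL(2, ZMod q) → CfLip := cfTwSingle q ξ₀ (cfGfam A Θ G s)

omit [NeZero q] in
/-- **Laplace transform of the congruence length count:** for `Re s > 0` and `G` real on `[0,1]`,
`∫_0^∞ N_n(e^{u/(2δ)}, x; ξ → ξ₀; G, Φ) e^{-su} du = s^{-1} (𝓜_{δs}ⁿ (G_s ⊗ δ_{ξ₀}))_ξ(x)`.
[cite: MageeOhWinter2019, §3.2 eq. (3.4)] -/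
theorem integral_cfCongLenCountT {G : CfLip} (hGre : ∀ y : Icc (0 : ℝ) 1, (((G y).re : ℝ) : ℂ) = G y)
    (ξ ξ₀ : SL(2, ZMod q)) (n : ℕ) (x : Icc (0 : ℝ) 1) {s : ℂ} (hs : 0 < s.re) :
    ∫ u in Set.Ioi (0 : ℝ), (cfCongLenCountT A Θ G ξ ξ₀ n (Real.exp (u / (2 * cfDimension A))) x : ℂ) * Complex.exp (-s * u) =
      ((cfTwist A hA q ((cfDimension A : ℂ) * s) ^ n) (cfCongFam A Θ G ξ₀ s) ξ x) / s := by
  simp_rw [cfCongLenCountT_mul_cexp_eq A hA h2 Θ G ξ ξ₀ n x s]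
  rw [integral_finsetSum _ fun w _ => ((integrableOn_indicator_exp _ hs).const_mul _).const_mul _,
    cfTwist_pow_apply, cfTwistSum_eq_sum A hA q _ n _ ξ x.2, Finset.sum_div]
  refine Finset.sum_congr rfl fun w _ => ?_
  set l := List.ofFn w
  have hptI := cfPathPoint_mem A hA l x.2
  have hd : 0 < cfDenom (cfPathMat A l) x := by linarith [one_le_cfDenom_cfPathMat A hA l x.2]
  have hq1 := one_le_cfDenom_cfPathMat A hA l x.2
  have hΦ := Θ.pos hptI
  have ht : 0 ≤ 2 * cfDimension A * Real.log (cfDenom (cfPathMat A l) x * Θ.Φ (cfPathPoint A l x)) :=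
    mul_nonneg (by linarith [cfDimension_pos hA h2]) (Real.log_nonneg (by nlinarith [Θ.one_le _ hptI]))
  rw [integral_const_mul, integral_const_mul, integral_indicator_exp ht hs, cexp_neg_mul_log_mul_eq A _ hd hΦ,
    show Complex.exp (-(2 * ((cfDimension A : ℂ) * s) * (Real.log (cfDenom (cfPathMat A l) x) : ℂ))) =
      cfWt ((cfDimension A : ℂ) * s) (cfPathMat A l) x from rfl, CfLip.extend_of_mem _ hptI]
  -- the family evaluated
  rw [cfCongFam, cfTwSingle_apply]
  by_cases hσ : ξ * cfSigmaWord A q l = ξ₀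
  · rw [if_pos hσ, if_pos hσ, CfLip.extend_of_mem _ hptI, cfGfam, Θ.cfPowFam_apply, ← hGre ⟨_, hptI⟩]
    push_cast
    simp only [Complex.ofReal_re]
    ring
  · rw [if_neg hσ, if_neg hσ]
    simp [CfLip.extend]

omit [NeZero q] in
/-- Integrability of the integrand. [folklore] -/
theorem integrable_cfCongLenCountT (G : CfLip) (ξ ξ₀ : SL(2, ZMod q)) (n : ℕ) (x : Icc (0 : ℝ) 1) {s : ℂ} (hs : 0 < s.re) :
    IntegrableOn (fun u : ℝ => (cfCongLenCountT A Θ G ξ ξ₀ n (Real.exp (u / (2 * cfDimension A))) x : ℂ) * Complex.exp (-s * u))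
      (Set.Ioi 0) := by
  have hterm := funext fun u => cfCongLenCountT_mul_cexp_eq A hA h2 Θ G ξ ξ₀ n x s u
  rw [show (fun u : ℝ => (cfCongLenCountT A Θ G ξ ξ₀ n (Real.exp (u / (2 * cfDimension A))) x : ℂ) * Complex.exp (-s * u)) = _ from hterm]
  exact integrable_finsetSum _ fun w _ => ((integrableOn_indicator_exp _ hs).const_mul _).const_mul _

omit [NeZero q] in
/-- The `L¹` norms (`G ≥ 0`): `∫_0^∞ N_n e^{-σu} ≤ ‖G‖ σ⁻¹ 4^{δσ} λ_{δσ}^{2n}`. [folklore] -/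
theorem integral_norm_cfCongLenCountT_le {G : CfLip} (hG0 : ∀ y : Icc (0 : ℝ) 1, 0 ≤ (G y).re) (ξ ξ₀ : SL(2, ZMod q)) (n : ℕ)
    (x : Icc (0 : ℝ) 1) {s : ℂ} (hs : 0 < s.re) :
    ∫ u in Set.Ioi (0 : ℝ), ‖(cfCongLenCountT A Θ G ξ ξ₀ n (Real.exp (u / (2 * cfDimension A))) x : ℂ) * Complex.exp (-s * u)‖ ≤
      ‖G‖ * ((4 : ℝ) ^ (cfDimension A * s.re) * cfEig A (cfDimension A * s.re) ^ (2 * n) / s.re) := by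
  have hi1 := (integrable_cfCongLenCountT A hA h2 Θ G ξ ξ₀ n x hs).norm
  have hi2 : Integrable (fun u : ℝ => ‖G‖ * ‖(cfLenCount A (2 * n) (Real.exp (u / (2 * cfDimension A))) x : ℂ) *
      Complex.exp (-s * u)‖) (volume.restrict (Set.Ioi 0)) := by
    have h := (integrable_cfLenCountW A hA h2 (CfLip.const 1) (2 * n) x hs).norm.const_mul ‖G‖
    simp_rw [cfLenCountW_const_one] at h
    exact h
  calc ∫ u in Set.Ioi (0 : ℝ), ‖(cfCongLenCountT A Θ G ξ ξ₀ n (Real.exp (u / (2 * cfDimension A))) x : ℂ) * Complex.exp (-s * u)‖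
      ≤ ∫ u in Set.Ioi (0 : ℝ), ‖G‖ * ‖(cfLenCount A (2 * n) (Real.exp (u / (2 * cfDimension A))) x : ℂ) * Complex.exp (-s * u)‖ := by
        refine integral_mono hi1 hi2 fun u => ?_
        show _ ≤ _
        have hre : (-s * (u : ℂ)).re = -s.re * u := by simp [Complex.mul_re]
        rw [norm_mul, Complex.norm_real, Real.norm_of_nonneg (cfCongLenCountT_nonneg A Θ hG0 ξ ξ₀ n _ x),
          norm_cfLenCount_mul_cexp, Complex.norm_exp, hre, ← mul_assoc]
        exact mul_le_mul_of_nonneg_right (cfCongLenCountT_le A hA Θ G ξ ξ₀ n _ x.2) (Real.exp_pos _).le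
    _ = ‖G‖ * ∫ u in Set.Ioi (0 : ℝ), ‖(cfLenCount A (2 * n) (Real.exp (u / (2 * cfDimension A))) x : ℂ) * Complex.exp (-s * u)‖ :=
        integral_const_mul _ _
    _ ≤ _ := mul_le_mul_of_nonneg_left (integral_norm_cfLenCount_le A hA h2 (2 * n) x hs) (norm_nonneg G)

omit hA h2 in
/-- The average of a single-fibre family: `Av (G ⊗ δ_{ξ₀}) = |Γ_q|⁻¹ G`. [folklore] -/
theorem cfTwAv_cfTwSingle (ξ₀ : SL(2, ZMod q)) (G : CfLip) :
    cfTwAv q (cfTwSingle q ξ₀ G) = ((Fintype.card (SL(2, ZMod q)) : ℂ)⁻¹) • G := by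
  rw [cfTwAv_apply]
  congr 1
  rw [Finset.sum_eq_single ξ₀ (fun ξ _ hne => by rw [cfTwSingle_apply, if_neg hne]) (fun h => absurd (Finset.mem_univ ξ₀) h),
    cfTwSingle_apply, if_pos rfl]

/-- `(1 - L_s²)⁻¹ = Σ_m L_s^{2m}` for `Re s > δ`, evaluated. [folklore] -/
theorem inverse_one_sub_cfLOp_sq_apply {s : ℂ} (hs : cfDimension A < s.re) (G : CfLip) (x : Icc (0 : ℝ) 1) :
    (Ring.inverse (1 - cfLOp A hA s ^ 2) : CfLip →L[ℂ] CfLip) G x =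
      (1 / 2 : ℂ) * (Ring.inverse (1 - cfLOp A hA s) G x + Ring.inverse (1 + cfLOp A hA s) G x) := by
  set L := cfLOp A hA s with hL
  have hsumN : Summable fun n => ‖L ^ n‖ := summable_norm_cfLOp_pow A hA h2 hs
  have hE : Summable fun m => ‖(L ^ 2) ^ m‖ := by
    have := hsumN.comp_injective (fun a b h => mul_left_cancel₀ two_ne_zero h : Function.Injective fun m : ℕ => 2 * m)
    exact this.congr fun m => by simp [Function.comp, pow_mul]
  rw [inverse_one_sub_eq_tsum hE, ← tsum_cfLOp_even_pow_apply A hA h2 hs G x]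
  have h := ((CfLip.eval x).comp (ContinuousLinearMap.apply ℂ CfLip G)).map_tsum hE.of_norm
  simp only [ContinuousLinearMap.coe_comp, Function.comp_apply, ContinuousLinearMap.apply_apply, CfLip.eval_apply] at h
  rw [show ((∑' m, (L ^ 2) ^ m) G) x = ∑' m, ((L ^ 2) ^ m) G x from h]
  exact tsum_congr fun m => by rw [← pow_mul]

/-- **The Laplace transform of the congruence count:** for `Re s > 1`, `G ≥ 0` real, primitive twists,
`∫_0^∞ N_q(e^{u/2δ}, x; ξ → ξ₀; G, Φ) e^{-su} du
  = |Γ_q|⁻¹ (½ s⁻¹ F_{G_s,x}(δs) + ½ s⁻¹ ((1 + L_{δs})⁻¹ G_s)(x)) + s⁻¹ (H(δs)(G_s ⊗ δ_{ξ₀}))_ξ(x)`.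
[cite: MageeOhWinter2019, §3.2 eq. (3.4)] -/
theorem cfCongLaplace_eq {G : CfLip} (hGre : ∀ y : Icc (0 : ℝ) 1, (((G y).re : ℝ) : ℂ) = G y)
    (hG0 : ∀ y : Icc (0 : ℝ) 1, 0 ≤ (G y).re) (ξ ξ₀ : SL(2, ZMod q)) (x : Icc (0 : ℝ) 1) {s : ℂ} (hs : 1 < s.re) :
    ∫ u in Set.Ioi (0 : ℝ), (cfCongCountT A Θ G ξ ξ₀ (Real.exp (u / (2 * cfDimension A))) x : ℂ) * Complex.exp (-s * u) =
      (((1 / 2 * (Fintype.card (SL(2, ZMod q)) : ℝ)⁻¹ : ℝ)) : ℂ) * cfResFun A hA (cfGfam A Θ G s) x ((cfDimension A : ℂ) * s) / s +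
        ((((1 / 2 * (Fintype.card (SL(2, ZMod q)) : ℝ)⁻¹ : ℝ)) : ℂ) * (Ring.inverse (1 + cfLOp A hA ((cfDimension A : ℂ) * s)) (cfGfam A Θ G s) x) +
          cfTwH A hA q ((cfDimension A : ℂ) * s) (cfCongFam A Θ G ξ₀ s) ξ x) / s := by
  have hs0 : 0 < s.re := by linarith
  have hδ := cfDimension_pos hA h2
  set f : ℕ → ℝ → ℂ := fun n u =>
    (cfCongLenCountT A Θ G ξ ξ₀ n (Real.exp (u / (2 * cfDimension A))) x : ℂ) * Complex.exp (-s * u) with hf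
  have hpt : ∀ u : ℝ, (cfCongCountT A Θ G ξ ξ₀ (Real.exp (u / (2 * cfDimension A))) x : ℂ) * Complex.exp (-s * u) = ∑' n, f n u := by
    intro u
    rw [cfCongCountT, Complex.ofReal_tsum, ← tsum_mul_right]
  simp_rw [hpt]
  have hint : ∀ n, Integrable (f n) (volume.restrict (Set.Ioi 0)) := fun n => integrable_cfCongLenCountT A hA h2 Θ G ξ ξ₀ n x hs0
  have hsum : Summable fun n => ∫ u, ‖f n u‖ ∂(volume.restrict (Set.Ioi 0)) := by
    refine Summable.of_nonneg_of_le (fun n => integral_nonneg fun u => norm_nonneg _)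
      (fun n => integral_norm_cfCongLenCountT_le A hA h2 Θ hG0 ξ ξ₀ n x hs0) ?_
    have h := summable_even_bound A hA h2 hs (‖G‖ * ((4 : ℝ) ^ (cfDimension A * s.re) / s.re))
    refine h.congr fun m => ?_
    ring
  rw [← integral_tsum_of_summable_integral_norm hint hsum]
  have hterm : ∀ n, ∫ u, f n u ∂(volume.restrict (Set.Ioi 0)) =
      ((cfTwist A hA q ((cfDimension A : ℂ) * s) ^ n) (cfCongFam A Θ G ξ₀ s) ξ x) / s := fun n =>
    integral_cfCongLenCountT A hA h2 Θ hGre ξ ξ₀ n x hs0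
  simp_rw [hterm]
  rw [tsum_div_const]
  -- `Σ_n (𝓜ⁿ Fam)_ξ(x) = ((1 - 𝓜)⁻¹ Fam)_ξ(x)`
  set s' : ℂ := (cfDimension A : ℂ) * s with hs'
  have hlt : cfDimension A < s'.re := by rw [hs', Complex.re_ofReal_mul]; nlinarith
  have hle : cfDimension A ≤ s'.re := hlt.le
  have hne : s' ≠ (cfDimension A : ℂ) := by
    intro h; rw [h, Complex.ofReal_re] at hlt; exact lt_irrefl _ hlt
  obtain ⟨hsumM, -⟩ := isUnit_one_sub_cfTwist_of_lt A hA h2 q hlt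
  set Fam := cfCongFam A Θ G ξ₀ s with hFam
  have hev : ∑' n, (cfTwist A hA q s' ^ n) Fam ξ x = (Ring.inverse (1 - cfTwist A hA q s')) Fam ξ x := by
    rw [inverse_one_sub_eq_tsum hsumM]
    have h := ((CfLip.eval x).comp ((ContinuousLinearMap.proj ξ).comp
      (ContinuousLinearMap.apply ℂ (SL(2, ZMod q) → CfLip) Fam))).map_tsum hsumM.of_norm
    simp only [ContinuousLinearMap.coe_comp, Function.comp_apply, ContinuousLinearMap.apply_apply,
      ContinuousLinearMap.proj_apply, CfLip.eval_apply] at h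
    exact h.symm
  rw [hev, cfTwist_inverse_eq_cfTwH A hA h2 q hle hne, _root_.add_apply, Pi.add_apply, CfLip.add_apply,
    cfTwLift_apply, hFam, cfCongFam, cfTwAv_cfTwSingle, map_smul, CfLip.smul_apply,
    inverse_one_sub_cfLOp_sq_apply A hA h2 hlt, ← cfCongFam, ← hFam, cfResFun]
  push_cast
  field_simp
  ring

/-! ### The congruence renewal theorem -/

/-- **The congruence renewal theorem (fixed `q`, main term):** for primitive twists, `G ≥ 0` real Lipschitz,
a Lipschitz threshold `Φ ≥ 1`, `x ∈ [0,1]` and fibres `ξ, ξ₀`,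
`N_q(X, x; ξ → ξ₀; G, Φ) / X^{2δ} → |Γ_q|⁻¹ · ½ ν(G Φ^{-2δ}) c(x)`, i.e. each residue class carries
`1/|SL₂(ℤ/qℤ)|` of the even-word asymptotic of `cfEvenCountT_asymp`.
[cite: MageeOhWinter2019, Thm. 11] -/
theorem cfCongCountT_asymp {n₀ : ℕ}
    (hprim : ∀ n ≥ n₀, ∀ ξ η : SL(2, ZMod q), ∃ w : List (A × A), w.length = n ∧ ξ * cfSigmaWord A q w = η)
    {G : CfLip} (hGre : ∀ y : Icc (0 : ℝ) 1, (((G y).re : ℝ) : ℂ) = G y)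
    (hG0 : ∀ y : Icc (0 : ℝ) 1, 0 ≤ (G y).re) (ξ ξ₀ : SL(2, ZMod q)) (x : Icc (0 : ℝ) 1) :
    Tendsto (fun X : ℝ => cfCongCountT A Θ G ξ ξ₀ X x / X ^ (2 * cfDimension A)) atTop
      (𝓝 ((Fintype.card (SL(2, ZMod q)) : ℝ)⁻¹ * cfEvenConst A hA h2 Θ G x)) := by
  have hδ := cfDimension_pos hA h2
  obtain ⟨K, hK, hb⟩ := cfFullCount_le hA h2
  set a : ℝ → ℝ := fun u => cfCongCountT A Θ G ξ ξ₀ (Real.exp (u / (2 * cfDimension A))) x with ha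
  have hmono : Monotone a := fun u v huv =>
    cfCongCountT_mono A hA Θ hG0 ξ ξ₀ x.2 (Real.exp_le_exp.2 (div_le_div_of_nonneg_right huv (by positivity)))
  have ha0 : ∀ u, 0 ≤ a u := fun u => cfCongCountT_nonneg A Θ hG0 ξ ξ₀ _ _
  have hbound : ∀ u, a u ≤ ‖G‖ * K * (1 + Real.exp u) := by
    intro u
    have hX0 : 0 ≤ Real.exp (u / (2 * cfDimension A)) := (Real.exp_pos _).le
    have h := hb x x.2 _ hX0
    have hpow : Real.exp (u / (2 * cfDimension A)) ^ (2 * cfDimension A) = Real.exp u := by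
      rw [← Real.exp_mul, div_mul_cancel₀ _ (by positivity)]
    rw [hpow] at h
    calc a u ≤ ‖G‖ * cfFullCount A (Real.exp (u / (2 * cfDimension A))) x := cfCongCountT_le_norm_mul A hA Θ G ξ ξ₀ x.2 _
      _ ≤ ‖G‖ * (K * (1 + Real.exp u)) := mul_le_mul_of_nonneg_left h (norm_nonneg G)
      _ = ‖G‖ * K * (1 + Real.exp u) := by ring
  have hGcont : ContinuousOn (cfGfam A Θ G) {s : ℂ | 1 ≤ s.re} := (Θ.continuous_cfPowFam G _).continuousOn
  have hGdiff : DifferentiableAt ℂ (fun s => cfNuL A hA h2 (cfGfam A Θ G s)) 1 := Θ.differentiableAt_cfNuL_cfPowFam hA h2 G _ 1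
  set α : ℝ := 1 / 2 * (Fintype.card (SL(2, ZMod q)) : ℝ)⁻¹ with hα
  set E : ℂ → ℂ := fun s =>
    ((α : ℂ) * (Ring.inverse (1 + cfLOp A hA ((cfDimension A : ℂ) * s)) (cfGfam A Θ G s) x) +
      cfTwH A hA q ((cfDimension A : ℂ) * s) (cfCongFam A Θ G ξ₀ s) ξ x) / s with hE
  have hEcont : ContinuousOn E {s : ℂ | 1 ≤ s.re} := by
    intro s₀ hs₀
    have hs₀re : 1 ≤ s₀.re := hs₀
    have hs₀0 : s₀ ≠ 0 := fun h => by rw [h, Complex.zero_re] at hs₀re; linarith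
    have hre : cfDimension A ≤ ((cfDimension A : ℂ) * s₀).re := by rw [Complex.re_ofReal_mul]; nlinarith
    have hmaps : MapsTo (fun s : ℂ => (cfDimension A : ℂ) * s) {s : ℂ | 1 ≤ s.re} {s : ℂ | cfDimension A ≤ s.re} := by
      intro s hs; show cfDimension A ≤ ((cfDimension A : ℂ) * s).re; rw [Complex.re_ofReal_mul]
      have : 1 ≤ s.re := hs; nlinarith
    -- first summand (as in the even case)
    have hR : ContinuousWithinAt (fun s => Ring.inverse (1 + cfLOp A hA ((cfDimension A : ℂ) * s))) {s : ℂ | 1 ≤ s.re} s₀ :=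
      ((continuousAt_inverse_one_add_cfLOp A hA h2 hre).comp (continuous_const.mul continuous_id).continuousAt).continuousWithinAt
    have h1 := hR.clm_apply (hGcont s₀ hs₀)
    have h1' := (CfLip.eval x).continuous.continuousAt.comp_continuousWithinAt h1
    -- second summand: `H(δ s)` applied to the continuous family
    have hH : ContinuousWithinAt (fun s => cfTwH A hA q ((cfDimension A : ℂ) * s)) {s : ℂ | 1 ≤ s.re} s₀ :=
      ((continuousOn_cfTwH A hA h2 q hprim).comp (continuous_const.mul continuous_id).continuousOn hmaps) s₀ hs₀
    have hFam : ContinuousWithinAt (fun s => cfCongFam A Θ G ξ₀ s) {s : ℂ | 1 ≤ s.re} s₀ :=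
      ((cfTwSingle q ξ₀).continuous.comp (Θ.continuous_cfPowFam G _)).continuousWithinAt
    have h3 := hH.clm_apply hFam
    have h3' := ((CfLip.eval x).comp (ContinuousLinearMap.proj (R := ℂ) (φ := fun _ : SL(2, ZMod q) => CfLip) ξ)).continuous.continuousAt.comp_continuousWithinAt h3
    have h4 : ContinuousWithinAt (fun s => (α : ℂ) * (Ring.inverse (1 + cfLOp A hA ((cfDimension A : ℂ) * s)) (cfGfam A Θ G s) x) +
        cfTwH A hA q ((cfDimension A : ℂ) * s) (cfCongFam A Θ G ξ₀ s) ξ x) {s : ℂ | 1 ≤ s.re} s₀ :=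
      (continuousWithinAt_const.mul h1').add h3'
    exact h4.div continuousWithinAt_id hs₀0
  have hLap : ∀ s : ℂ, 1 < s.re → ∫ u in Set.Ioi (0 : ℝ), (a u : ℂ) * Complex.exp (-s * u) =
      (α : ℂ) * cfResFun A hA (cfGfam A Θ G s) x ((cfDimension A : ℂ) * s) / s + E s :=
    fun s hs => cfCongLaplace_eq A hA h2 Θ hGre hG0 ξ ξ₀ x hs
  have hlim := tendsto_of_cfLaplace A hA h2 hmono ha0 (by positivity : 0 ≤ ‖G‖ * K) hbound hGcont hGdiff
    (cfNuL_cfGfam_one A hA h2 Θ hGre) α hEcont x hLap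
  have h := tendsto_rpow_of_tendsto_exp A (N := fun X => cfCongCountT A Θ G ξ ξ₀ X x) hδ hlim
  have e : α * cfInt (cfNuδ A hA h2) (fun y => (G.extend y).re * Θ.Φ y ^ (-(2 * cfDimension A))) * cfHδ A hA h2 x /
      (cfDimension A * cfInt (cfNuδ A hA h2) (cfG A hA h2)) = (Fintype.card (SL(2, ZMod q)) : ℝ)⁻¹ * cfEvenConst A hA h2 Θ G x := by
    simp only [cfEvenConst, hα]; ring
  rw [← e]
  exact h

end Laplace

end CongRenewal

end Literature.NumberTheory.Sieve
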